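import Literature.MathematicalPhysics.QuantumFieldTheory.Balaban1983to89.B6Cov2156TorusDelK
import Literature.MathematicalPhysics.QuantumFieldTheory.Balaban1983to89.T4Rate166StripDirect
import Literature.MathematicalPhysics.QuantumFieldTheory.King1986.CovarianceRate

/-!
# G-an2-4 ∕ (CONV-C), route R7, letter ledger item (L3)-Γ_u — PART 1 (INPUTS): THE TORUS SOCKET FOR BAŁABAN's STEP COVARIANCE
# `C(C*ΔC)⁻¹C*` ([B6] (2.156)) AND THE DIFFERENCE LETTER OF THE GENUINE `Δ_k` BETWEEN ANY TWO LEVELS ON EVERY TORUS AT KING'S RATE `n⁻²`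

G-an2-4 formalisation swarm `b2b-balaban-gan24-formalise-*`, leaf prover 06 (gen 39 = prover-b2b-balaban-gan24-formalise-leaf-06-g39-0), CRUX TEAM
(2) under the coordinator ruling «YM REDIRECT TOWARDS THE SUMMIT» (e34b3e0c; FREEZE (0) honoured — a `GAN24/` corollary importing EXISTING modules
only; INTENT «STEP-COVARIANCE-TWO-CLAUSES», HOME/CLAIMS.log 2026-08-21 l.33123, statement-first with hold-off; PART 2 = `StepCovarianceTwoClauses`).
OBJECT: the covariance of the k-th step unit-lattice Gaussian of Bałaban's renormalization transformation at `U = 1` — [Balaban1984PropagatorsII]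
p. 249 (2.152) «const ∫dB δ(QB)δ_{Ax}(B) e^{−½⟨B,Δ_kB⟩}F(B) … the covariance of the Gaussian integration in (2.152) … C^{(k)}», p. 250 (2.156)
«C^{(k)}_Λ = C(C*Δ_kC)⁻¹C*» — the UNIT-LATTICE LETTER `Γ = C^{(k)}(1)` of an1's (MF′) in the printed axial gauge «QB = 0, B(Γ_{y,x}) = 0», typed
END TO END by the pv09 torus line as `(B6Cov2156Torus.bondReductionT L M Δ).cov` (`elimT L M` = the explicit C of p. 250) with `Δ = reDelK n hn M`
(the genuine (1.65) operator `Beta.BlockEffectiveAction.DelK` in the bond basis, a-free).  THIS PART (0 def, 0 sorry):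
 * §1 `sandwichCov_sub_eq` — the resolvent identity `E(EᵀΔE)⁻¹Eᵀ − E(EᵀΔ′E)⁻¹Eᵀ = [E(EᵀΔE)⁻¹Eᵀ](Δ′ − Δ)[E(EᵀΔ′E)⁻¹Eᵀ]` for units (King's
   (4.39)–(4.40) `King1986.CovarianceRate.inv_sub_inv_of_isUnit`, printed for the soft constraint `aL⁻²Q*Q`, dressed by an elimination matrix).
 * §2 pv09's periodic distance (`pdist_triangle`, `pdist_nonneg`) and the torus profile `sum_exp_pdist_le` (`Σ_q e^{−aρ_M(p₋,q₋)} ≤ N·K_m(a)`,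
   `perSum_le` + `box_separated`) — the `V` of King's (4.41).
 * §2′ THE TORUS SOCKET (background-agnostic; the plug for `U ≠ 1` ∕ other-letter suppliers): `sandwichCov_sub_apply_eq` and
   **`sandwichCov_two_levels_of_inputs`** — `∃ c δ > 0` chosen after `(m, L, γ, c₀, δ₀)`, BEFORE the torus and the operators, such that on every
   torus `L ∣ M_i`, for ANY two symmetric `Δ, Δ′` with kernels `≤ c₀e^{−δ₀ρ_M}`, (2.153)-coercive with constant `γ` (`LowerOnConstrainedT`) and
   `|Δ′ − Δ| ≤ ε·e^{−δ₀ρ_M}`: (i) `|C_Δ(b,b′)| ≤ c·e^{−δρ_M(b₋,b′₋)}` (pv09's `bond250_torusT`) and (ii) `|C_{Δ′}(b,b′) − C_Δ(b,b′)| ≤ c·ε·e^{−δρ_M}`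
   (§1 with pv09's `sandwich_posDef` + King's (4.41) three-factor convolution `King1986.CovarianceRate.triple_decay_bound` with §2's profile).
 * §3 THE DIFFERENCE LETTER OF THE GENUINE `Δ_k`, EVERY TORUS, ANY TWO LEVELS, KING'S RATE: `abs_inner_sub_inner_le` (pv09's EXACT bond-basis
   identity `B5Kernel166Decay.inner_eq` has LEVEL-FREE coefficients `dirInd`, so the `(μ,ν)` terms of `Re Δ` DIFFERENCE LINEARLY and NE2's
   every-torus (1.66) strip rate `T4Rate166StripDirect.ksum_rate2` bounds the four entry kernels), `abs_sum_sum_sub_le`, and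
   **`abs_reDelK_sub_le`**: `|Re Δ_m(b,b′) − Re Δ_n(b,b′)| ≤ (d+1)²·32·C166(d+1)·periodConst·n⁻²·e^{−(κ166∕(d+1))ρ_M(b₋,b′₋)}` for `1 ≤ n ≤ m`,
   every period vector `M` (`deltaPol_eq_reDelK`, `deltaPol_eq_sum`, b05's `pdist_le_torusSupNorm`).
HONEST SCOPE.  [folklore] junctions of tree theorems BY NAME + one resolvent identity; §2′'s inputs are a HYPOTHESIS SHAPE asserted of nothing
(PART 2 discharges them for the genuine `Δ_k` at `U = 1`); nothing printed enters as a hypothesis (ABSOLUTE RULE); [Balaban1984PropagatorsI]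
(1.65)–(1.66), [Balaban1984PropagatorsII] (2.152)–(2.157), [King1986] (4.39)–(4.41) are TEXT LOCATIONS.  PRIOR ART credited: the road-P2 chair's
ℤ^{d+1} END `DirichletExhaustionCoer.convC_balaban` (p199806 ✓; (CONV-C) for the ℤ^{d+1} typing `covPad (elimZ L) (deltaZ L) (IsFreeZ L) Λ`,
θ = L⁻²) — this file and PART 2 are the TORUS siblings in pv09's typing; no junction `deltaZ` ↔ `reDelK` is claimed.  NOT (CONV-C) as typed,
NEVER «G-an2-4 closed», NOT NE2 ∕ NE3, NOT D1, NOT BetaPertH, NOT continuum, NOT Clay — not in print as stated; our bookkeeping.  HONEST DEPENDENCY: continuum YM on T⁴ ⇐ BetaPertH ∧ nine spine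
estimates (0/9 proved); BetaPertH ⇐ (D1) ∧ (D4) ∧ CAP+tail; G-an2-4 gates asym, D1 and NE2/3/4.
-/

noncomputable section

open scoped BigOperators Matrix
open Finset

namespace Summit.QuantumFields.BalabanUV.Beta.GAN24.StepCovarianceInputs

open Literature.MathematicalPhysics.QuantumFieldTheory.Balaban1983to89
open B5Prop11Plancherel (Tor)
open B6LowerBound2153Torus (toT)
open B6Lemma24Torus (pbox)
open B4TorusKernel (periodConst)
open B4TorusKernel.MultiPeriod (torusSupNorm)
open B4Sect5Proof (latticeConst)
open B5Symbol166Strip (kappa166 kappa166_pos)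
open B6BondEliminationTorus (pdist perSum_le box_separated zdPer)
open B6Cov2156Torus (bondReductionT elimT one_le_M LowerOnConstrainedT bond250_torusT wgt phiC)
open B6Jacobian2155Torus (sandwich_posDef)
open B6Cov2156TorusDelK (reDelK deltaPol_eq_reDelK)
open B5Kernel166Decay (ksum inner_eq inner_eq_zero_of_eq deltaPol_eq_sum norm_dirInd_le dirInd toT_sub periodConst_pos
  pdist_le_torusSupNorm)
open T4Rate166StripDirect (ksum_rate2 C166 C166_pos)
open Literature.MathematicalPhysics.QuantumFieldTheory.King1986 (inv_sub_inv_of_isUnit triple_decay_bound)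

/-! ## §1 The resolvent identity for the sandwich covariance `E(EᵀΔE)⁻¹Eᵀ` -/

section Resolvent

variable {ι κ : Type*} [Fintype ι] [Fintype κ] [DecidableEq κ]

/-- **RESOLVENT IDENTITY FOR THE SANDWICH COVARIANCE OF (2.156)**: if `EᵀΔE` and `EᵀΔ′E` are units then
`E(EᵀΔE)⁻¹Eᵀ − E(EᵀΔ′E)⁻¹Eᵀ = [E(EᵀΔE)⁻¹Eᵀ]·(Δ′ − Δ)·[E(EᵀΔ′E)⁻¹Eᵀ]` — King's resolvent identity (4.39)–(4.40)
(`King1986.inv_sub_inv_of_isUnit`, printed for `(Δ + aL⁻²Q*Q)⁻¹`) dressed by the elimination matrix of Bałaban's hard constraints.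
[cite: King1986, (4.39)–(4.40) pp.674–675; Balaban1984PropagatorsII, (2.156) p.250] [folklore] -/
theorem sandwichCov_sub_eq (E : Matrix ι κ ℝ) (Δ Δ' : Matrix ι ι ℝ)
    (h : IsUnit (Eᵀ * Δ * E)) (h' : IsUnit (Eᵀ * Δ' * E)) :
    E * (Eᵀ * Δ * E)⁻¹ * Eᵀ - E * (Eᵀ * Δ' * E)⁻¹ * Eᵀ
      = (E * (Eᵀ * Δ * E)⁻¹ * Eᵀ) * (Δ' - Δ) * (E * (Eᵀ * Δ' * E)⁻¹ * Eᵀ) := by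
  have key : Eᵀ * (Δ' - Δ) * E = Eᵀ * Δ' * E - Eᵀ * Δ * E := by rw [Matrix.mul_sub, Matrix.sub_mul]
  calc E * (Eᵀ * Δ * E)⁻¹ * Eᵀ - E * (Eᵀ * Δ' * E)⁻¹ * Eᵀ = E * ((Eᵀ * Δ * E)⁻¹ - (Eᵀ * Δ' * E)⁻¹) * Eᵀ := by
        rw [Matrix.mul_sub, Matrix.sub_mul]
    _ = E * ((Eᵀ * Δ * E)⁻¹ * (Eᵀ * Δ' * E - Eᵀ * Δ * E) * (Eᵀ * Δ' * E)⁻¹) * Eᵀ := by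
        rw [inv_sub_inv_of_isUnit _ _ h h']
    _ = E * ((Eᵀ * Δ * E)⁻¹ * (Eᵀ * (Δ' - Δ) * E) * (Eᵀ * Δ' * E)⁻¹) * Eᵀ := by rw [key]
    _ = (E * (Eᵀ * Δ * E)⁻¹ * Eᵀ) * (Δ' - Δ) * (E * (Eᵀ * Δ' * E)⁻¹ * Eᵀ) := by simp only [Matrix.mul_assoc]

end Resolvent

/-! ## §2 Three decaying kernels convolved on the bonds of a torus, uniformly in the period -/

section Convolution

variable {m N : ℕ} (M : Fin m → ℕ) [∀ μ, NeZero (M μ)]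

/-- the periodic distance satisfies the triangle inequality (pv09's periodic frame `zdPer`). [folklore] -/
theorem pdist_triangle (x y z : Fin m → ℤ) :
    pdist M (one_le_M M) x z ≤ pdist M (one_le_M M) x y + pdist M (one_le_M M) y z :=
  (zdPer m M (one_le_M M)).ρ_triangle x y z

/-- the periodic distance is non-negative. [folklore] -/
theorem pdist_nonneg (x y : Fin m → ℤ) : 0 ≤ pdist M (one_le_M M) x y :=
  (zdPer m M (one_le_M M)).ρ_nonneg x y

/-- the lattice-sum profile on the bonds of the torus: `Σ_q e^{−aρ_M(p₋,q₋)} ≤ N·K_m(a)`, uniformly in the period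
(pv09's `perSum_le` on the separated box). [folklore] -/
theorem sum_exp_pdist_le {a : ℝ} (ha : 0 < a) (p : B4.Idx (pbox M) N) :
    ∑ q : B4.Idx (pbox M) N, Real.exp (-(a * pdist M (one_le_M M) (p.1 : Fin m → ℤ) (q.1 : Fin m → ℤ)))
      ≤ (N : ℝ) * latticeConst m a :=
  perSum_le (N := N) (Ω := pbox M) (box_separated M (one_le_M M)) ha p

end Convolution

/-! ## §2′ The torus socket: two symmetric, decaying, (2.153)-coercive operators on one torus -/

section Socket

variable {m : ℕ}

/-- the resolvent identity ENTRYWISE on pv09's (2.156) object for two ARBITRARY symmetric operators `Δ, Δ′` on the bond variables of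
one torus, each (2.153)-coercive on the constrained subspace (invertibility of `CᵀΔC`, `CᵀΔ′C` = pv09's `sandwich_posDef`):
`C_{Δ′}(b,b′) − C_Δ(b,b′) = [C(CᵀΔ′C)⁻¹Cᵀ·(Δ − Δ′)·C(CᵀΔC)⁻¹Cᵀ](b,b′)`. [cite: Balaban1984PropagatorsII, (2.153)–(2.156) pp.249–250] [folklore] -/
theorem sandwichCov_sub_apply_eq {L : ℕ} {M : Fin m → ℕ} [∀ μ, NeZero (M μ)] (hL : 0 < L) (hLM : ∀ i, L ∣ M i)
    {Δ Δ' : Matrix (B4.Idx (pbox M) m) (B4.Idx (pbox M) m) ℝ} (hs : Δ.IsSymm) (hs' : Δ'.IsSymm) {γ : ℝ} (hγ : 0 < γ)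
    (hl : LowerOnConstrainedT L M Δ γ) (hl' : LowerOnConstrainedT L M Δ' γ) (p q : B4.Idx (pbox M) m) :
    (bondReductionT L M Δ').cov p q - (bondReductionT L M Δ).cov p q
      = ((elimT L M * ((elimT L M)ᵀ * Δ' * elimT L M)⁻¹ * (elimT L M)ᵀ) * (Δ - Δ')
          * (elimT L M * ((elimT L M)ᵀ * Δ * elimT L M)⁻¹ * (elimT L M)ᵀ)) p q := by
  rw [← sandwichCov_sub_eq (elimT L M) Δ' Δ (sandwich_posDef hL hLM hs' hγ hl').isUnit (sandwich_posDef hL hLM hs hγ hl).isUnit,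
    Matrix.sub_apply]
  rfl

variable (m) in
/-- **THE TORUS SOCKET** (background-agnostic; the shape a `U ≠ 1` or every-torus supplier of `Δ_k`-letters plugs into): for `L ≥ 1` and
positive `(γ, c₀, δ₀)` there are `c, δ > 0` — chosen after `(m, L, γ, c₀, δ₀)`, BEFORE the torus and the operators — such that on EVERY torus
`M` with `L ∣ M_i`, for ANY two symmetric operators `Δ, Δ′` on its bond variables with kernels `≤ c₀e^{−δ₀ρ_M}`, (2.153)-coercive with constant `γ`
on the constrained subspace, and with `|Δ′ − Δ| ≤ ε·e^{−δ₀ρ_M}` entrywise: (i) `|C_Δ(b,b′)| ≤ c·e^{−δρ_M(b₋,b′₋)}` (pv09's `bond250_torusT`) and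
(ii) `|C_{Δ′}(b,b′) − C_Δ(b,b′)| ≤ c·ε·e^{−δρ_M(b₋,b′₋)}` (resolvent identity + King's (4.41) three-factor convolution with the torus profile).
[cite: Balaban1984PropagatorsII, (2.152)–(2.157) pp.249–250; King1986, (4.39)–(4.41) pp.674–675] [folklore] -/
theorem sandwichCov_two_levels_of_inputs {L : ℕ} (hL : 0 < L) {γ c₀ δ₀ : ℝ} (hγ : 0 < γ) (hc : 0 < c₀) (hδ : 0 < δ₀) :
    ∃ c δ : ℝ, 0 < c ∧ 0 < δ ∧
      ∀ (M : Fin m → ℕ) [∀ μ, NeZero (M μ)], (∀ i, L ∣ M i) →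
        ∀ (Δ Δ' : Matrix (B4.Idx (pbox M) m) (B4.Idx (pbox M) m) ℝ), Δ.IsSymm → Δ'.IsSymm →
        (∀ p q : B4.Idx (pbox M) m, |Δ p q| ≤ c₀ * Real.exp (-(δ₀ * pdist M (one_le_M M) (p.1 : Fin m → ℤ) (q.1 : Fin m → ℤ)))) →
        (∀ p q : B4.Idx (pbox M) m, |Δ' p q| ≤ c₀ * Real.exp (-(δ₀ * pdist M (one_le_M M) (p.1 : Fin m → ℤ) (q.1 : Fin m → ℤ)))) →
        LowerOnConstrainedT L M Δ γ → LowerOnConstrainedT L M Δ' γ →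
        ∀ {ε : ℝ}, 0 ≤ ε →
        (∀ p q : B4.Idx (pbox M) m, |Δ' p q - Δ p q| ≤ ε * Real.exp (-(δ₀ * pdist M (one_le_M M) (p.1 : Fin m → ℤ) (q.1 : Fin m → ℤ)))) →
        ∀ p q : B4.Idx (pbox M) m,
          |(bondReductionT L M Δ).cov p q| ≤ c * Real.exp (-(δ * pdist M (one_le_M M) (p.1 : Fin m → ℤ) (q.1 : Fin m → ℤ))) ∧
          |(bondReductionT L M Δ').cov p q - (bondReductionT L M Δ).cov p q|
            ≤ c * ε * Real.exp (-(δ * pdist M (one_le_M M) (p.1 : Fin m → ℤ) (q.1 : Fin m → ℤ))) := by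
  obtain ⟨c, δ, hc', hδ', H⟩ := bond250_torusT m hL hγ hc hδ
  set α : ℝ := min δ δ₀ with hα
  have hα0 : 0 < α := lt_min hδ' hδ
  have hαδ : α ≤ δ := min_le_left _ _
  have hαδ₀ : α ≤ δ₀ := min_le_right _ _
  set K : ℝ := (m : ℝ) * latticeConst m (α / 2) with hK
  refine ⟨max c (c * c * K ^ 2), α / 2, lt_max_of_lt_left hc', half_pos hα0,
    fun M _ hLM Δ Δ' hs hs' hd hd' hl hl' ε hε hdiff p q => ?_⟩
  have hmono : ∀ {β β' : ℝ} (u v : B4.Idx (pbox M) m), β' ≤ β →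
      Real.exp (-(β * pdist M (one_le_M M) (u.1 : Fin m → ℤ) (v.1 : Fin m → ℤ)))
        ≤ Real.exp (-(β' * pdist M (one_le_M M) (u.1 : Fin m → ℤ) (v.1 : Fin m → ℤ))) :=
    fun u v hβ => Real.exp_le_exp.mpr (neg_le_neg (mul_le_mul_of_nonneg_right hβ (pdist_nonneg _ _ _)))
  have hα2α : α / 2 ≤ α := by linarith
  have HΔ := H M hLM Δ hs hd hl
  have HΔ' := H M hLM Δ' hs' hd' hl'
  constructor
  · exact (HΔ p q).trans (mul_le_mul (le_max_left _ _) (hmono p q (hα2α.trans hαδ)) (Real.exp_pos _).le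
      (hc'.le.trans (le_max_left _ _)))
  · rw [sandwichCov_sub_apply_eq hL hLM hs hs' hγ hl hl' p q]
    have hX : ∀ u v : B4.Idx (pbox M) m, |(elimT L M * ((elimT L M)ᵀ * Δ' * elimT L M)⁻¹ * (elimT L M)ᵀ) u v|
        ≤ c * Real.exp (-(α * pdist M (one_le_M M) (u.1 : Fin m → ℤ) (v.1 : Fin m → ℤ))) :=
      fun u v => (HΔ' u v).trans (mul_le_mul_of_nonneg_left (hmono u v hαδ) hc'.le)
    have hZ : ∀ u v : B4.Idx (pbox M) m, |(elimT L M * ((elimT L M)ᵀ * Δ * elimT L M)⁻¹ * (elimT L M)ᵀ) u v|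
        ≤ c * Real.exp (-(α * pdist M (one_le_M M) (u.1 : Fin m → ℤ) (v.1 : Fin m → ℤ))) :=
      fun u v => (HΔ u v).trans (mul_le_mul_of_nonneg_left (hmono u v hαδ) hc'.le)
    have hY : ∀ u v : B4.Idx (pbox M) m, |(Δ - Δ') u v|
        ≤ ε * Real.exp (-(α * pdist M (one_le_M M) (u.1 : Fin m → ℤ) (v.1 : Fin m → ℤ))) := by
      intro u v
      rw [Matrix.sub_apply, abs_sub_comm]
      exact (hdiff u v).trans (mul_le_mul_of_nonneg_left (hmono u v hαδ₀) hε)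
    refine (triple_decay_bound (fun u v : B4.Idx (pbox M) m => pdist M (one_le_M M) (u.1 : Fin m → ℤ) (v.1 : Fin m → ℤ))
      (fun u v => pdist_nonneg _ _ _) (fun u v w => pdist_triangle _ _ _ _) _ _ _ hα0.le hc'.le hε
      hX hY hZ (fun u => sum_exp_pdist_le M (half_pos hα0) u) p q).trans ?_
    have e : c * ε * c * ((m : ℝ) * latticeConst m (α / 2)) ^ 2 = (c * c * K ^ 2) * ε := by rw [hK]; ring
    rw [e]
    calc c * c * K ^ 2 * ε * Real.exp (-(α / 2 * pdist M (one_le_M M) (p.1 : Fin m → ℤ) (q.1 : Fin m → ℤ)))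
        ≤ max c (c * c * K ^ 2) * ε * Real.exp (-(α / 2 * pdist M (one_le_M M) (p.1 : Fin m → ℤ) (q.1 : Fin m → ℤ))) :=
          mul_le_mul_of_nonneg_right (mul_le_mul_of_nonneg_right (le_max_right _ _) hε) (Real.exp_pos _).le
      _ = _ := by ring

end Socket

/-! ## §3 The difference letter of the genuine `Δ_k` between ANY two levels on EVERY torus (NE2's (1.66) strip rate) -/

section DeltaRate

variable {d : ℕ} (M : Fin (d + 1) → ℕ) [hM : ∀ μ, NeZero (M μ)]

/-- the `(μ,ν)` term of `Re Δ_k` in the bond basis DIFFERENCES LINEARLY between two levels `n ≤ m`: pv09's EXACT identity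
`inner_eq` has level-free coefficients (`dirInd`, of norm `≤ 1`), so NE2's every-torus (1.66) strip rate `ksum_rate2` for the four entry
kernels gives `|term_m − term_n| ≤ 4·(8·C166∕n²)·periodConst·e^{−(κ166∕(d+1))|p₋ − q₋|_T}`; the `μ = ν` term vanishes at both levels.
[cite: Balaban1984PropagatorsI, (1.66) p.29] [folklore] -/
theorem abs_inner_sub_inner_le {n m : ℕ} [NeZero n] [NeZero m] (hnm : n ≤ m) (p q : B4.Idx (pbox M) (d + 1)) (μ ν : Fin (d + 1)) :
    |(∑ t : Tor M, wgt M m ((μ, ν), t) * ((starRingEnd ℂ) (phiC M (Pi.single p 1) μ ν t) * phiC M (Pi.single q 1) μ ν t).re)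
      - ∑ t : Tor M, wgt M n ((μ, ν), t) * ((starRingEnd ℂ) (phiC M (Pi.single p 1) μ ν t) * phiC M (Pi.single q 1) μ ν t).re|
      ≤ 4 * (8 * C166 (d + 1) / (n : ℝ) ^ 2 * periodConst (kappa166 (d + 1)) d *
          Real.exp (-(kappa166 (d + 1) / (d + 1) * torusSupNorm M ((p.1 : Fin (d + 1) → ℤ) - (q.1 : Fin (d + 1) → ℤ))))) := by
  set R : ℝ := 8 * C166 (d + 1) / (n : ℝ) ^ 2 * periodConst (kappa166 (d + 1)) d *
    Real.exp (-(kappa166 (d + 1) / (d + 1) * torusSupNorm M ((p.1 : Fin (d + 1) → ℤ) - (q.1 : Fin (d + 1) → ℤ)))) with hR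
  have hR0 : 0 ≤ R := by
    have := C166_pos (d + 1); have := periodConst_pos (kappa166_pos (d + 1)) d
    positivity
  by_cases hμν : μ = ν
  · subst hμν
    rw [inner_eq_zero_of_eq, inner_eq_zero_of_eq, sub_zero, abs_zero]
    positivity
  rw [inner_eq, inner_eq, ← Complex.sub_re, toT_sub]
  -- the four entry-kernel differences
  set x : Fin (d + 1) → ℤ := (p.1 : Fin (d + 1) → ℤ) - (q.1 : Fin (d + 1) → ℤ) with hx
  have hK : ∀ a b : Fin (d + 1), ‖ksum M m μ ν a b (toT M x) - ksum M n μ ν a b (toT M x)‖ ≤ R :=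
    fun a b => ksum_rate2 M hnm hμν a b x
  set a := ((dirInd M ν p : ℝ) : ℂ) with ha_def
  set b := ((dirInd M ν q : ℝ) : ℂ) with hb_def
  set c := ((dirInd M μ p : ℝ) : ℂ) with hc_def
  set e := ((dirInd M μ q : ℝ) : ℂ) with he_def
  have ha : ‖a‖ ≤ 1 := norm_dirInd_le M ν p
  have hb : ‖b‖ ≤ 1 := norm_dirInd_le M ν q
  have hc : ‖c‖ ≤ 1 := norm_dirInd_le M μ p
  have he : ‖e‖ ≤ 1 := norm_dirInd_le M μ q
  have hι : ∀ (s s' K : ℂ), ‖s‖ ≤ 1 → ‖s'‖ ≤ 1 → ‖K‖ ≤ R → ‖s * s' * K‖ ≤ R := by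
    intro s s' K hs hs' hK'
    rw [norm_mul, norm_mul]
    calc ‖s‖ * ‖s'‖ * ‖K‖ ≤ 1 * 1 * R := by gcongr
      _ = R := by ring
  refine (Complex.abs_re_le_norm _).trans ?_
  have e4 : ∀ (K1 K2 K3 K4 K1' K2' K3' K4' : ℂ),
      (a * b * K1 - a * e * K2 - c * b * K3 + c * e * K4) - (a * b * K1' - a * e * K2' - c * b * K3' + c * e * K4')
        = a * b * (K1 - K1') - a * e * (K2 - K2') - c * b * (K3 - K3') + c * e * (K4 - K4') := by
    intros; ring
  rw [e4]
  calc ‖a * b * (ksum M m μ ν μ μ (toT M x) - ksum M n μ ν μ μ (toT M x))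
        - a * e * (ksum M m μ ν μ ν (toT M x) - ksum M n μ ν μ ν (toT M x))
        - c * b * (ksum M m μ ν ν μ (toT M x) - ksum M n μ ν ν μ (toT M x))
        + c * e * (ksum M m μ ν ν ν (toT M x) - ksum M n μ ν ν ν (toT M x))‖
      ≤ ‖a * b * (ksum M m μ ν μ μ (toT M x) - ksum M n μ ν μ μ (toT M x))
          - a * e * (ksum M m μ ν μ ν (toT M x) - ksum M n μ ν μ ν (toT M x))
          - c * b * (ksum M m μ ν ν μ (toT M x) - ksum M n μ ν ν μ (toT M x))‖
        + ‖c * e * (ksum M m μ ν ν ν (toT M x) - ksum M n μ ν ν ν (toT M x))‖ := norm_add_le _ _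
    _ ≤ ‖a * b * (ksum M m μ ν μ μ (toT M x) - ksum M n μ ν μ μ (toT M x))
          - a * e * (ksum M m μ ν μ ν (toT M x) - ksum M n μ ν μ ν (toT M x))‖
        + ‖c * b * (ksum M m μ ν ν μ (toT M x) - ksum M n μ ν ν μ (toT M x))‖
        + ‖c * e * (ksum M m μ ν ν ν (toT M x) - ksum M n μ ν ν ν (toT M x))‖ := by
        gcongr; exact norm_sub_le _ _
    _ ≤ ‖a * b * (ksum M m μ ν μ μ (toT M x) - ksum M n μ ν μ μ (toT M x))‖
        + ‖a * e * (ksum M m μ ν μ ν (toT M x) - ksum M n μ ν μ ν (toT M x))‖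
        + ‖c * b * (ksum M m μ ν ν μ (toT M x) - ksum M n μ ν ν μ (toT M x))‖
        + ‖c * e * (ksum M m μ ν ν ν (toT M x) - ksum M n μ ν ν ν (toT M x))‖ := by
        gcongr; exact norm_sub_le _ _
    _ ≤ R + R + R + R := by
        gcongr
        · exact hι _ _ _ ha hb (hK μ μ)
        · exact hι _ _ _ ha he (hK μ ν)
        · exact hι _ _ _ hc hb (hK ν μ)
        · exact hι _ _ _ hc he (hK ν ν)
    _ = 4 * R := by ring

omit hM in
/-- a double sum of termwise-close families is close: `|Σ_iΣ_j f − Σ_iΣ_j g| ≤ |ι|²·R`. [folklore] -/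
theorem abs_sum_sum_sub_le {ι : Type*} [Fintype ι] (f g : ι → ι → ℝ) {R : ℝ} (h : ∀ i j, |f i j - g i j| ≤ R) :
    |∑ i, ∑ j, f i j - ∑ i, ∑ j, g i j| ≤ (Fintype.card ι : ℝ) ^ 2 * R := by
  rw [← Finset.sum_sub_distrib]
  calc |∑ i, (∑ j, f i j - ∑ j, g i j)| ≤ ∑ i, |∑ j, f i j - ∑ j, g i j| := Finset.abs_sum_le_sum_abs _ _
    _ ≤ ∑ i : ι, ∑ _j : ι, R := Finset.sum_le_sum fun i _ => by
        rw [← Finset.sum_sub_distrib]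
        exact (Finset.abs_sum_le_sum_abs _ _).trans (Finset.sum_le_sum fun j _ => h i j)
    _ = (Fintype.card ι : ℝ) ^ 2 * R := by
        rw [Finset.sum_const, Finset.sum_const, Finset.card_univ, nsmul_eq_mul, nsmul_eq_mul]; ring

/-- **THE DIFFERENCE LETTER OF THE GENUINE `Δ_k` BETWEEN ANY TWO LEVELS ON EVERY TORUS, AT KING'S RATE `n⁻²`**:
`|Re Δ_m(b,b′) − Re Δ_n(b,b′)| ≤ (d+1)²·4·8·C166(d+1)·periodConst·n⁻²·e^{−(κ166∕(d+1))ρ_M(b₋,b′₋)}` for `1 ≤ n ≤ m`, every period vector `M`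
— pv09's `deltaPol_eq_reDelK` ∕ `deltaPol_eq_sum` + `abs_inner_sub_inner_le` + b05's `pdist_le_torusSupNorm`.
[cite: Balaban1984PropagatorsI, (1.65)–(1.66) p.29] [folklore] -/
theorem abs_reDelK_sub_le {n m : ℕ} (hn : 1 ≤ n) (hm : 1 ≤ m) (hnm : n ≤ m) (p q : B4.Idx (pbox M) (d + 1)) :
    |reDelK m hm M p q - reDelK n hn M p q|
      ≤ ((d : ℝ) + 1) ^ 2 * (4 * (8 * C166 (d + 1) * periodConst (kappa166 (d + 1)) d)) * ((n : ℝ) ^ 2)⁻¹ *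
          Real.exp (-(kappa166 (d + 1) / (d + 1) * pdist M (one_le_M M) (p.1 : Fin (d + 1) → ℤ) (q.1 : Fin (d + 1) → ℤ))) := by
  haveI : NeZero n := ⟨by omega⟩
  haveI : NeZero m := ⟨by omega⟩
  rw [← deltaPol_eq_reDelK m hm M, ← deltaPol_eq_reDelK n hn M, deltaPol_eq_sum, deltaPol_eq_sum]
  have hκ : 0 < kappa166 (d + 1) / (d + 1) := div_pos (kappa166_pos _) (by positivity)
  have hexp : Real.exp (-(kappa166 (d + 1) / (d + 1) * torusSupNorm M ((p.1 : Fin (d + 1) → ℤ) - (q.1 : Fin (d + 1) → ℤ))))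
      ≤ Real.exp (-(kappa166 (d + 1) / (d + 1) * pdist M (one_le_M M) (p.1 : Fin (d + 1) → ℤ) (q.1 : Fin (d + 1) → ℤ))) :=
    Real.exp_le_exp.mpr (neg_le_neg (mul_le_mul_of_nonneg_left (pdist_le_torusSupNorm M _ _) hκ.le))
  have hC0 : 0 ≤ ((d : ℝ) + 1) ^ 2 * (4 * (8 * C166 (d + 1) * periodConst (kappa166 (d + 1)) d)) * ((n : ℝ) ^ 2)⁻¹ := by
    have := C166_pos (d + 1); have := periodConst_pos (kappa166_pos (d + 1)) d
    positivity
  refine (abs_sum_sum_sub_le _ _ (fun μ ν => abs_inner_sub_inner_le M hnm p q μ ν)).trans ?_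
  rw [Fintype.card_fin]
  calc ((d + 1 : ℕ) : ℝ) ^ 2 * (4 * (8 * C166 (d + 1) / (n : ℝ) ^ 2 * periodConst (kappa166 (d + 1)) d *
          Real.exp (-(kappa166 (d + 1) / (d + 1) * torusSupNorm M ((p.1 : Fin (d + 1) → ℤ) - (q.1 : Fin (d + 1) → ℤ))))))
      = ((d : ℝ) + 1) ^ 2 * (4 * (8 * C166 (d + 1) * periodConst (kappa166 (d + 1)) d)) * ((n : ℝ) ^ 2)⁻¹ *
          Real.exp (-(kappa166 (d + 1) / (d + 1) * torusSupNorm M ((p.1 : Fin (d + 1) → ℤ) - (q.1 : Fin (d + 1) → ℤ)))) := by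
        push_cast; ring
    _ ≤ _ := mul_le_mul_of_nonneg_left hexp hC0

end DeltaRate

end Summit.QuantumFields.BalabanUV.Beta.GAN24.StepCovarianceInputs

end
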